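import Summits.BirchSwinnertonDyer.BirchSwinnertonDyer.Theorems.CountingDoorF2AtThreeWeakLeafAtTwo
import Summits.BirchSwinnertonDyer.BirchSwinnertonDyer.Theorems.CountingDoorF2AtThreeRootNumberClosedForm
import Literature.NumberTheory.EllipticCurves.BhargavaHo2022.SelmerTwoAverage
import HarnessLib

/-!
# BirchSwinnertonDyer / CountingDoorF2AtThree — the door at `p = 2` BY NAME: Bhargava–Ho Thm 1.1(g)/1.2
# (`BhargavaHo2022.thm1_2_F2_selmerTwo`) + Y₂ ⟹ the weak leaf at `2`

Seat bsd-rank2-rootno-p2 GEN 5. One-line corollaries of `CountingDoorF2AtThreeWeakLeafAtTwo.lean`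
(p562433) with the hypothesis `hBH` supplied BY NAME from the Literature fact
`Literature.NumberTheory.EllipticCurves.BhargavaHo2022.thm1_2_F2_selmerTwo` (p563006; its body is `hBH`
verbatim). So «rank = 2 ∧ Ш[2^∞] = 0 for a positive proportion of every large `Φ ⊆ F₂`» is a theorem modulo
the two PRINT fact packs (`LargeFamilyInputsF2` = BH Thm 9.1/10.1; `thm1_2_F2_selmerTwo` = BH Thm 1.1(g)/1.2)
and the ONE open input Y₂ «`dens{#Sel₂ = 8} < 1/2`»; on the refined door family, modulo `thm1_2_F2_selmerTwo`
and Y₂ only. §2 spells Y₂ in lane B's ROOT-NUMBER currency: a bias bound `limsup avg(−w) ≤ θ` and an odd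
`2`-Selmer tail `liminf dens{w = −1 ∧ #Sel₂ ≥ 32} ≥ z` with `θ < 2z` give Y₂ (`ρ ≥ (1 − θ)/2`,
`F2RootNumber.densityOnGE_rootNumber_of_averageOnLE`); so, modulo print, «root-number EQUIDISTRIBUTION on
large `Φ` (`θ = 0`, Helfgott's conjecture for `F₂`) + ANY positive odd `2`-Selmer tail» already gives the weak
leaf at `2` — whereas the `p = 3` door needs I1 and the `2/3`-bias only. THEOREMS ONLY; standard axioms. PARTITION: none — r_an ≥ 2, summit axis S0; TWIN n/a; B1: no
analytic rank; no S0 motion.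

References: M. Bhargava, W. Ho, arXiv:2207.03309 Thm. 1.1(g), 1.2, 9.1, 10.1 [BhargavaHo2022];
B. Poonen, E. Rains, J. AMS 25 (2012) [PoonenRains2012].
-/

set_option linter.dupNamespace false

noncomputable section

open scoped Classical
open Filter Topology
open WeierstrassCurve Literature.NumberTheory.EllipticCurves
  Literature.NumberTheory.EllipticCurves.BhargavaHo2022
  Summit.BirchSwinnertonDyer.Rank2
  Summit.BirchSwinnertonDyer.BirchSwinnertonDyer.Theses.CountingDoorF2AtThree

namespace Summit.BirchSwinnertonDyer.BirchSwinnertonDyer.Theorems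

/-- **The weak leaf at `2` on every large family, BY NAME**: modulo BH Thm 9.1/10.1 (`LargeFamilyInputsF2`),
BH Thm 1.1(g)/1.2 (`thm1_2_F2_selmerTwo`) and Y₂, in every large `Φ ⊆ F₂` with nonempty residue sets the
members with `rank = 2 ∧ Ш[2^∞] = 0` have positive lower density.
[cite: BhargavaHo2022, Thm. 1.1(g), Thm. 1.2, Thm. 9.1, Thm. 10.1] -/
theorem weakLeafAtTwo_of_thm1_2_of_neCubeTwo (hLF : LargeFamilyInputsF2) (hBH : thm1_2_F2_selmerTwo)
    (hY₂ : ∀ Φ : CongruenceFamily₂, Φ.IsLarge → (∀ p : ℕ, p.Prime → (Φ.residues p).Nonempty) →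
      ∃ κ : ℝ, 1 / 2 < κ ∧ Φ.DensityOnGE (fun a ↦ Nat.card (a.curve.selmerGroup 2) ≠ 8) κ)
    (Φ : CongruenceFamily₂) (hL : Φ.IsLarge) (hne : ∀ p : ℕ, p.Prime → (Φ.residues p).Nonempty) :
    Φ.HasPositiveLowerDensityOn (fun a ↦ a.IsMember ∧ a.curve.mordellWeilRank = 2 ∧
      AddCommGroup.primaryComponent a.curve.sha 2 = ⊥) :=
  weakLeafAtTwo_of_selmerTwoAverage_of_neCubeTwo hLF hBH hY₂ Φ hL hne

/-- **The weak leaf at `2` on `F₂`, BY NAME.** [cite: BhargavaHo2022, Thm. 1.1(g), Thm. 1.2, Thm. 10.1] -/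
theorem weakLeafAtTwo_all_of_thm1_2_of_neCubeTwo (hLF : LargeFamilyInputsF2) (hBH : thm1_2_F2_selmerTwo)
    (hY₂ : ∀ Φ : CongruenceFamily₂, Φ.IsLarge → (∀ p : ℕ, p.Prime → (Φ.residues p).Nonempty) →
      ∃ κ : ℝ, 1 / 2 < κ ∧ Φ.DensityOnGE (fun a ↦ Nat.card (a.curve.selmerGroup 2) ≠ 8) κ) :
    CongruenceFamily₂.all.HasPositiveLowerDensityOn (fun a ↦ a.IsMember ∧
      a.curve.mordellWeilRank = 2 ∧ AddCommGroup.primaryComponent a.curve.sha 2 = ⊥) :=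
  weakLeafAtTwo_all_of_selmerTwoAverage_of_neCubeTwo hLF hBH hY₂

/-- **The weak leaf at `2` on the refined door family, BY NAME, modulo `thm1_2_F2_selmerTwo` and Y₂ ONLY.**
[cite: BhargavaHo2022, Thm. 1.1(g) and Thm. 1.2] -/
theorem exists_weakLeafAtTwo_of_thm1_2_of_neCubeTwo (hBH : thm1_2_F2_selmerTwo)
    (hY₂ : ∀ Φ : CongruenceFamily₂, Φ.IsLarge → (∀ p : ℕ, p.Prime → (Φ.residues p).Nonempty) →
      ∃ κ : ℝ, 1 / 2 < κ ∧ Φ.DensityOnGE (fun a ↦ Nat.card (a.curve.selmerGroup 2) ≠ 8) κ) :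
    ∃ Φ : CongruenceFamily₂, Φ.IsLarge ∧ (∀ p : ℕ, p.Prime → (Φ.residues p).Nonempty) ∧
      Φ.HasPositiveLowerDensityOn (fun a ↦ a.IsMember ∧ a.curve.mordellWeilRank = 2 ∧
        AddCommGroup.primaryComponent a.curve.sha 2 = ⊥) :=
  exists_weakLeafAtTwo_of_selmerTwoAverage_of_neCubeTwo hBH hY₂

/-! ### §2 Y₂ in root-number currency: bias `θ` + odd `2`-Selmer tail `z` with `θ < 2z` -/

/-- **The weak leaf at `2` from a root-number BIAS bound and an odd `2`-Selmer tail** (modulo the two print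
fact packs and Dokchitser–Dokchitser / Monsky `2`-parity): if on every large `Φ ⊆ F₂` with nonempty residue
sets `limsup avg(−w(E_a)) ≤ θ` and `liminf dens{w = −1 ∧ #Sel₂ ≥ 32} ≥ z` with `θ < 2z`, then on every such
`Φ` the members with `rank = 2 ∧ Ш[2^∞] = 0` have positive lower density (`ρ ≥ (1 − θ)/2`, so `ρ + z > 1/2`,
i.e. Y₂). With root-number EQUIDISTRIBUTION (`θ = 0`, Helfgott's conjecture for `F₂`; Poonen–Rains) any
`z > 0` suffices; I2's `2/3`-bias alone does not (`θ < 2z ≈ 0.16` under Poonen–Rains).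
[cite: BhargavaHo2022, Thm. 1.1(g), Thm. 1.2; DokchitserDokchitserAnnals2010, Thm 1.4; Helfgott2004RootNumber, §1] -/
theorem weakLeafAtTwo_of_thm1_2_of_bias_add_oddTail (hLF : LargeFamilyInputsF2)
    (hDD : even_selmerRank_sub_torsionRank_iff) (hBH : thm1_2_F2_selmerTwo)
    (h : ∀ Φ : CongruenceFamily₂, Φ.IsLarge → (∀ p : ℕ, p.Prime → (Φ.residues p).Nonempty) →
      ∃ θ z : ℝ, θ < 2 * z ∧ Φ.AverageOnLE (fun a ↦ -(a.curve.rootNumber : ℝ)) θ ∧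
        Φ.DensityOnGE (fun a ↦ a.curve.rootNumber = -1 ∧ 32 ≤ Nat.card (a.curve.selmerGroup 2)) z)
    (Φ : CongruenceFamily₂) (hL : Φ.IsLarge) (hne : ∀ p : ℕ, p.Prime → (Φ.residues p).Nonempty) :
    Φ.HasPositiveLowerDensityOn (fun a ↦ a.IsMember ∧ a.curve.mordellWeilRank = 2 ∧
      AddCommGroup.primaryComponent a.curve.sha 2 = ⊥) := by
  refine weakLeafAtTwo_of_thm1_2_of_neCubeTwo hLF hBH
    (neCubeTwoDensity_of_rootNumber_add_oddTail hLF hDD fun Ψ hΨ hneΨ ↦ ?_) Φ hL hne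
  obtain ⟨θ, z, hθz, hA, hT⟩ := h Ψ hΨ hneΨ
  have hB : ∀ᶠ X : ℕ in atTop, 0 < (Ψ.below X).card :=
    eventually_card_below_pos_of_densityOnGE Ψ
      (densityOnGE_of_hasDensityOn Ψ (genericMembersLargeF2 hLF Ψ hΨ hneΨ)) one_pos
  exact ⟨(1 - θ) / 2, z, by linarith, F2RootNumber.densityOnGE_rootNumber_of_averageOnLE Ψ hB hA,
    densityOnGE_mono Ψ hT fun a ha ↦ ⟨ha.1, le_trans (by norm_num) ha.2⟩⟩

end Summit.BirchSwinnertonDyer.BirchSwinnertonDyer.Theorems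

end
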